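import Summits.CriticalPhenomena.SAWScalingLimit.Theorems.SAWLeftRightFKGLeftRightFKGStubCornerAssemblyTerm
import HarnessLib

/-!
# Stub `stub_cornerAssembly` of line `corner-localisation` (lead c1 reshape v5): the assembly

Crux `LeftRightFKG` (stmt-CriticalPhenomena-11232), decl
`Summit.CriticalPhenomena.SAWScalingLimit.Theses.SAWLeftRightFKG.LeftRightFKG`. This file proves the registered stub

  `stub_cornerAssembly : (∀ Ω δ a b, ClassDictionaryAt Ω δ a b) → (∀ x > 0, AllMeetProportionalAt x) →
     (∀ x > 0, InterlacedTP2At x → CornerQuadrupleTP2At x) → InterlacedTP2At x_c → CornerCritical`,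

i.e. corner positivity at `x_c` of every prefix/suffix class of every crux instance from the interlacing-only
boundary TP₂ of the critical SAW path kernel (`BoundaryTP2.InterlacedTP2At x_c`, the induction form of the core of
the sibling crux `BoundaryTP2`, stmt-CriticalPhenomena-7115). With the landed stubs `stub_classDictionary`,
`stub_allMeetProportional`, `stub_cornerQuadruple` and the landed Transfer `stub_reduction : CornerCritical →
LeftRightFKG` (p98583) this makes `LeftRightFKG` a kernel-checked consequence of that one named statement.

Proof (fugacity-parametric, `corner_of_parts`): fix an instance, a class and `Γ = restrP k π m σ Sa Sb`; pass to the
real block form (`EndpointMonotone.μx_bi_iff`). If `Γ` has at most one chord the inequality is trivial. Otherwise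
split off the DIRECT chord `π k ∼ σ m` if present (`block_general`: it is `≼`-comparable with every chord, helper
file 2, so `corner_of_remove` of helper file 1 applies) and treat the rest (`block_noDirect`): decompose the four
sums by direction classes (helper file 1), and compare crossed with nested products termwise (`term_le`, previous
file).
-/

noncomputable section

open Finset SimpleGraph
open Literature.Probability.LatticeModels Literature.Probability.RandomPlanarGeometry
open scoped Classical ENNReal

namespace Summit.CriticalPhenomena.SAWScalingLimit.Theorems.LeftRightFKG.CornerLoc

namespace CornerAssembly

section Blocks

variable {δ : ℝ} {c a b a' b' : Site 2} {C : (zdGraph 2).Walk c c} {k : ℕ} {π : ℕ → Site 2} {m : ℕ}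
  {σ : ℕ → Site 2}

/-- THE BLOCK INEQUALITY WITHOUT DIRECT CHORD: for a finite set `s` of chords of one class, closed under direction
classes and consisting of chords of length `≥ k + m + 2`, and relative up-sets `A` (next-step determined), `B`
(previous-step determined): `w(s ∩ A) w(s ∩ B) ≤ w(s) w(s ∩ A ∩ B)` at fugacity `x`. [folklore] -/
theorem block_noDirect {x : ℝ} (hx : 0 < x) (hD : ClassDictionaryAt (dom C δ) δ a b) (hP : AllMeetProportionalAt x)
    (hQ : CornerQuadrupleTP2At x) (hI : IsInst δ a b a' b' C) [Fintype (SAW.DomainSAW (dom C δ) δ a b)]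
    {r r' : Site 2 → ℕ} (hrinj : Set.InjOn r ((zdGraph 2).neighborSet (π k)))
    (hr : ∀ γ₁ γ₂ : SAW.DomainSAW (dom C δ) δ a b, AgreeTo k π γ₁ → AgreeTo k π γ₂ → lr γ₁ γ₂ →
      r (γ₁.walk.getVert (k + 1)) ≤ r (γ₂.walk.getVert (k + 1)))
    (hr'inj : Set.InjOn r' ((zdGraph 2).neighborSet (σ m)))
    (hr' : ∀ γ₁ γ₂ : SAW.DomainSAW (dom C δ) δ a b, AgreeToR m σ γ₁ → AgreeToR m σ γ₂ → lr γ₁ γ₂ →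
      r' (γ₁.walk.reverse.getVert (m + 1)) ≤ r' (γ₂.walk.reverse.getVert (m + 1)))
    {A B : Set (SAW.DomainSAW (dom C δ) δ a b)} (hA : IsUpOn (cls k π m σ) A) (hB : IsUpOn (cls k π m σ) B)
    (hAn : NextDet k A) (hBp : PrevDet m B) (s : Finset (SAW.DomainSAW (dom C δ) δ a b))
    (hs1 : ∀ γ ∈ s, γ ∈ cls k π m σ)
    (hs2 : ∀ γ : SAW.DomainSAW (dom C δ) δ a b, γ ∈ cls k π m σ →
      (∃ γ' ∈ s, γ'.walk.getVert (k + 1) = γ.walk.getVert (k + 1)) →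
      (∃ γ'' ∈ s, γ''.walk.reverse.getVert (m + 1) = γ.walk.reverse.getVert (m + 1)) → γ ∈ s)
    (hnd : ∀ γ ∈ s, k + m + 2 ≤ γ.length) :
    (∑ γ ∈ s.filter (· ∈ A), x ^ γ.length) * (∑ γ ∈ s.filter (· ∈ B), x ^ γ.length) ≤
      (∑ γ ∈ s, x ^ γ.length) * ∑ γ ∈ (s.filter (· ∈ A)).filter (· ∈ B), x ^ γ.length := by
  have hw0 : ∀ γ ∈ s, 0 ≤ x ^ γ.length := fun γ _ => pow_nonneg hx.le _
  -- at most one chord: trivial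
  by_cases h2s : ∃ γ₁ ∈ s, ∃ γ₂ ∈ s, γ₁ ≠ γ₂
  swap
  · push Not at h2s
    exact EndpointMonotone.bi_of_const s _ A B hw0 fun γ₁ h₁ γ₂ h₂ => by rw [h2s γ₁ h₁ γ₂ h₂]
  obtain ⟨γ₁, hγ₁, γ₂, hγ₂, hne⟩ := h2s
  have h2 : ∃ γ₁ γ₂ : SAW.DomainSAW (dom C δ) δ a b, γ₁ ∈ cls k π m σ ∧ γ₂ ∈ cls k π m σ ∧ γ₁ ≠ γ₂ :=
    ⟨γ₁, γ₂, hs1 _ hγ₁, hs1 _ hγ₂, hne⟩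
  -- direction labels and the induced row / column events
  set nx : SAW.DomainSAW (dom C δ) δ a b → Site 2 := fun γ => γ.walk.getVert (k + 1) with hnx
  set pv : SAW.DomainSAW (dom C δ) δ a b → Site 2 := fun γ => γ.walk.reverse.getVert (m + 1) with hpv
  set pE : Site 2 → Prop := fun u => ∃ γ ∈ s, nx γ = u ∧ γ ∈ A with hpE
  set pF : Site 2 → Prop := fun w => ∃ γ ∈ s, pv γ = w ∧ γ ∈ B with hpF
  have hAiff : ∀ γ ∈ s, (γ ∈ A ↔ pE (nx γ)) := fun γ hγ =>
    ⟨fun h => ⟨γ, hγ, rfl, h⟩, fun ⟨γ', _, h', h'A⟩ => (hAn γ γ' h'.symm).2 h'A⟩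
  have hBiff : ∀ γ ∈ s, (γ ∈ B ↔ pF (pv γ)) := fun γ hγ =>
    ⟨fun h => ⟨γ, hγ, rfl, h⟩, fun ⟨γ', _, h', h'B⟩ => (hBp γ γ' h'.symm).2 h'B⟩
  -- the four sums as double sums over directions
  set Z : Site 2 → Site 2 → ℝ := fun u w => ∑ γ ∈ s.filter (fun γ => nx γ = u ∧ pv γ = w), x ^ γ.length with hZ
  have eA : ∑ γ ∈ s.filter (· ∈ A), x ^ γ.length = ∑ u ∈ (s.image nx).filter pE, ∑ w ∈ s.image pv, Z u w := by
    have h := sum_filter_eq_sum_dir s nx pv (fun γ => x ^ γ.length) pE (fun _ => True)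
    rw [filter_true_of_mem (fun _ _ => trivial)] at h
    rw [← h]
    exact sum_congr (filter_congr fun γ hγ => by rw [hAiff γ hγ, and_true]) fun _ _ => rfl
  have eB : ∑ γ ∈ s.filter (· ∈ B), x ^ γ.length = ∑ u ∈ s.image nx, ∑ w ∈ (s.image pv).filter pF, Z u w := by
    have h := sum_filter_eq_sum_dir s nx pv (fun γ => x ^ γ.length) (fun _ => True) pF
    rw [filter_true_of_mem (fun _ _ => trivial)] at h
    rw [← h]
    exact sum_congr (filter_congr fun γ hγ => by rw [hBiff γ hγ, true_and]) fun _ _ => rfl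
  have eT : ∑ γ ∈ s, x ^ γ.length = ∑ u ∈ s.image nx, ∑ w ∈ s.image pv, Z u w :=
    sum_eq_sum_dir s nx pv _
  have eAB : ∑ γ ∈ (s.filter (· ∈ A)).filter (· ∈ B), x ^ γ.length =
      ∑ u ∈ (s.image nx).filter pE, ∑ w ∈ (s.image pv).filter pF, Z u w := by
    rw [← sum_filter_eq_sum_dir s nx pv (fun γ => x ^ γ.length) pE pF, filter_filter]
    exact sum_congr (filter_congr fun γ hγ => by rw [hAiff γ hγ, hBiff γ hγ]) fun _ _ => rfl
  rw [eA, eB, eT, eAB]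
  refine block_of_termwise (s.image nx) (s.image pv) pE pF Z
    (fun u _ w _ => sum_nonneg fun γ hγ => hw0 γ (mem_filter.1 hγ).1) ?_
  intro u hu u' hu' w hw w' hw' hEu hEu' hFw hFw'
  exact term_le hx hD hP hQ hI hrinj hr hr'inj hr' hA hB hAn hBp s hs1 hs2 hnd h2 hu hu' hw hw' hEu hEu' hFw hFw'

/-- THE BLOCK INEQUALITY FOR `Γ = restrP k π m σ Sa Sb` (direct chord included): corner positivity of one class of
a crux instance at fugacity `x`, in real block form. [folklore] -/
theorem block_general {x : ℝ} (hx : 0 < x) (hD : ClassDictionaryAt (dom C δ) δ a b) (hP : AllMeetProportionalAt x)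
    (hQ : CornerQuadrupleTP2At x) (hI : IsInst δ a b a' b' C) [Fintype (SAW.DomainSAW (dom C δ) δ a b)]
    {r r' : Site 2 → ℕ} (hrinj : Set.InjOn r ((zdGraph 2).neighborSet (π k)))
    (hr : ∀ γ₁ γ₂ : SAW.DomainSAW (dom C δ) δ a b, AgreeTo k π γ₁ → AgreeTo k π γ₂ → lr γ₁ γ₂ →
      r (γ₁.walk.getVert (k + 1)) ≤ r (γ₂.walk.getVert (k + 1)))
    (hr'inj : Set.InjOn r' ((zdGraph 2).neighborSet (σ m)))
    (hr' : ∀ γ₁ γ₂ : SAW.DomainSAW (dom C δ) δ a b, AgreeToR m σ γ₁ → AgreeToR m σ γ₂ → lr γ₁ γ₂ →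
      r' (γ₁.walk.reverse.getVert (m + 1)) ≤ r' (γ₂.walk.reverse.getVert (m + 1)))
    {A B : Set (SAW.DomainSAW (dom C δ) δ a b)} (hA : IsUpOn (cls k π m σ) A) (hB : IsUpOn (cls k π m σ) B)
    (hAn : NextDet k A) (hBp : PrevDet m B) (Sa Sb : Set (Site 2)) (s : Finset (SAW.DomainSAW (dom C δ) δ a b))
    (hs : s = univ.filter (· ∈ restrP k π m σ Sa Sb)) :
    (∑ γ ∈ s.filter (· ∈ A), x ^ γ.length) * (∑ γ ∈ s.filter (· ∈ B), x ^ γ.length) ≤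
      (∑ γ ∈ s, x ^ γ.length) * ∑ γ ∈ (s.filter (· ∈ A)).filter (· ∈ B), x ^ γ.length := by
  have hw0 : ∀ γ ∈ s, 0 ≤ x ^ γ.length := fun γ _ => pow_nonneg hx.le _
  have hmem : ∀ γ, γ ∈ s ↔ γ ∈ restrP k π m σ Sa Sb := fun γ => by simp [hs]
  have hs1 : ∀ γ ∈ s, γ ∈ cls k π m σ := fun γ hγ => ((hmem γ).1 hγ).1
  -- at most one chord: trivial
  by_cases h2s : ∃ γ₁ ∈ s, ∃ γ₂ ∈ s, γ₁ ≠ γ₂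
  swap
  · push Not at h2s
    exact EndpointMonotone.bi_of_const s _ A B hw0 fun γ₁ h₁ γ₂ h₂ => by rw [h2s γ₁ h₁ γ₂ h₂]
  obtain ⟨γ₁, hγ₁, γ₂, hγ₂, hne⟩ := h2s
  have hlong : ∀ γ ∈ s, k + m + 1 ≤ γ.length := fun γ hγ => le_length_of_two (hs1 _ hγ₁) (hs1 _ hγ₂) hne (hs1 _ hγ)
  -- the part without the direct chord
  set s' := s.filter (fun γ => k + m + 2 ≤ γ.length) with hs'
  have hs'1 : ∀ γ ∈ s', γ ∈ cls k π m σ := fun γ hγ => hs1 γ (mem_filter.1 hγ).1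
  have hs'nd : ∀ γ ∈ s', k + m + 2 ≤ γ.length := fun γ hγ => (mem_filter.1 hγ).2
  have hs'2 : ∀ γ : SAW.DomainSAW (dom C δ) δ a b, γ ∈ cls k π m σ →
      (∃ γ' ∈ s', γ'.walk.getVert (k + 1) = γ.walk.getVert (k + 1)) →
      (∃ γ'' ∈ s', γ''.walk.reverse.getVert (m + 1) = γ.walk.reverse.getVert (m + 1)) → γ ∈ s' := by
    rintro γ hγc ⟨γ', hγ', e'⟩ ⟨γ'', hγ'', e''⟩
    have hγ's := (hmem γ').1 (mem_filter.1 hγ').1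
    have hγ''s := (hmem γ'').1 (mem_filter.1 hγ'').1
    have hγs : γ ∈ s := (hmem γ).2 ⟨hγc, e' ▸ hγ's.2.1, e'' ▸ hγ''s.2.2⟩
    refine mem_filter.2 ⟨hγs, ?_⟩
    by_contra hlt
    have hL : γ.length = k + m + 1 := by have := hlong γ hγs; omega
    have hfix : γ.walk.getVert (k + 1) ∈ fixedSet k π m σ := by
      rw [next_eq_of_length_eq hγc hL]; exact Or.inr ⟨m, le_rfl, rfl⟩
    rw [← e'] at hfix
    exact next_not_mem_fixedSet (hs'1 _ hγ') (hs'nd _ hγ') hfix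
  have key := block_noDirect hx hD hP hQ hI hrinj hr hr'inj hr' hA hB hAn hBp s' hs'1 hs'2 hs'nd
  -- either no direct chord, or exactly one
  by_cases hdir : ∃ γ₀ ∈ s, γ₀.length = k + m + 1
  swap
  · have hss' : s' = s := by
      refine filter_true_of_mem fun γ hγ => ?_
      have := hlong γ hγ
      by_contra h
      exact hdir ⟨γ, hγ, by omega⟩
    rw [hss'] at key
    exact key
  obtain ⟨γ₀, hγ₀, hL₀⟩ := hdir
  have hγ₀s' : γ₀ ∉ s' := fun h => by have := (mem_filter.1 h).2; omega
  have hins : s = insert γ₀ s' := by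
    ext γ
    simp only [mem_insert, hs', mem_filter]
    constructor
    · intro hγ
      by_cases hL : k + m + 2 ≤ γ.length
      · exact Or.inr ⟨hγ, hL⟩
      · left
        have := hlong γ hγ
        exact direct_unique (hs1 _ hγ) (hs1 _ hγ₀) (by omega) hL₀
    · rintro (rfl | ⟨hγ, -⟩)
      · exact hγ₀
      · exact hγ
  -- comparability of the direct chord with the rest
  have hcomp : ∀ γ ∈ s', lr γ₀ γ ∨ lr γ γ₀ := fun γ hγ =>
    direct_comparable hI (hs1 _ hγ₀) (hs'1 _ hγ) (fun h => hγ₀s' (h ▸ hγ)) hL₀.le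
  have hw0' : ∀ γ ∈ s', 0 ≤ x ^ γ.length := fun γ _ => pow_nonneg hx.le _
  have hEF : γ₀ ∈ A → γ₀ ∉ B →
      ∑ γ ∈ s'.filter (· ∈ B), x ^ γ.length ≤ ∑ γ ∈ (s'.filter (· ∈ A)).filter (· ∈ B), x ^ γ.length := by
    intro h₀A h₀B
    refine sum_le_sum_of_subset_of_nonneg (fun γ hγ => ?_) fun γ hγ _ => hw0' γ (mem_filter.1 (mem_filter.1 hγ).1).1
    obtain ⟨hγs', hγB⟩ := mem_filter.1 hγ
    refine mem_filter.2 ⟨mem_filter.2 ⟨hγs', ?_⟩, hγB⟩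
    rcases hcomp γ hγs' with h | h
    · exact hA γ₀ γ (hs1 _ hγ₀) (hs'1 _ hγs') h h₀A
    · exact absurd (hB γ γ₀ (hs'1 _ hγs') (hs1 _ hγ₀) h hγB) h₀B
  have hFE : γ₀ ∈ B → γ₀ ∉ A →
      ∑ γ ∈ s'.filter (· ∈ A), x ^ γ.length ≤ ∑ γ ∈ (s'.filter (· ∈ A)).filter (· ∈ B), x ^ γ.length := by
    intro h₀B h₀A
    refine sum_le_sum_of_subset_of_nonneg (fun γ hγ => ?_) fun γ hγ _ => hw0' γ (mem_filter.1 (mem_filter.1 hγ).1).1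
    obtain ⟨hγs', hγA⟩ := mem_filter.1 hγ
    refine mem_filter.2 ⟨hγ, ?_⟩
    rcases hcomp γ hγs' with h | h
    · exact hB γ₀ γ (hs1 _ hγ₀) (hs'1 _ hγs') h h₀B
    · exact absurd (hA γ γ₀ (hs'1 _ hγs') (hs1 _ hγ₀) h hγA) h₀A
  -- split off `γ₀` from the four sums and conclude with `corner_of_remove`
  have eAB : ∀ t : Finset (SAW.DomainSAW (dom C δ) δ a b),
      (t.filter (· ∈ A)).filter (· ∈ B) = t.filter (fun γ => γ ∈ A ∧ γ ∈ B) := fun t => filter_filter _ _ t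
  rw [hins, sum_filter_insert' hγ₀s', sum_filter_insert' hγ₀s', sum_insert hγ₀s', eAB, sum_filter_insert' hγ₀s',
    ← eAB, add_comm (x ^ γ₀.length)]
  exact corner_of_remove (sum_nonneg fun γ hγ => hw0' γ (mem_filter.1 (mem_filter.1 hγ).1).1) (pow_nonneg hx.le _)
    (sum_filter_add_sum_filter_le s' _ hw0' _ _) key (γ₀ ∈ A) (γ₀ ∈ B) hEF hFE

end Blocks

/-! ## The assembly -/

/-- CORNER POSITIVITY FROM THE FOUR PARTS, at every fugacity `x > 0`: the class dictionary, proportional rows under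
all-meet, and signed corner quadruples at fugacity `x` give `Corner x`. [folklore] -/
theorem corner_of_parts {x : ℝ} (hx : 0 < x) (hD : ∀ (Ω : Set ℂ) (δ : ℝ) (a b : Site 2), ClassDictionaryAt Ω δ a b)
    (hP : AllMeetProportionalAt x) (hQ : CornerQuadrupleTP2At x) : Corner x := by
  intro δ c a b a' b' C hI k π m σ Sa Sb A B hA hB hAn hBp
  have hSM : StepMonotone := stub_stepMonotone stub_meshReduction stub_loopWindVanish
  obtain ⟨hfin, hRN, hRP⟩ := hSM δ c a b a' b' C hI
  haveI : Finite (SAW.DomainSAW (dom C δ) δ a b) := hfin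
  haveI : Fintype (SAW.DomainSAW (dom C δ) δ a b) := Fintype.ofFinite _
  obtain ⟨r, hrinj, hr⟩ := hRN k π
  obtain ⟨r', hr'inj, hr'⟩ := hRP m σ
  rw [EndpointMonotone.μx_bi_iff hx.le]
  exact block_general hx (hD _ _ _ _) hP hQ hI hrinj hr hr'inj hr' hA hB (hAn rfl) (hBp rfl) Sa Sb _ rfl

end CornerAssembly

/-- REGISTERED STUB `stub_cornerAssembly` of line `corner-localisation` (lead c1 reshape v5): the class dictionary,
proportional rows under all-meet, the corner-quadruple extension of the interlacing-only TP₂ and the CORE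
`BoundaryTP2.InterlacedTP2At x_c` (interlacing-only boundary TP₂ of the critical self-avoiding path kernel — the
induction form of the core of the sibling crux `BoundaryTP2`, stmt-CriticalPhenomena-7115) give corner positivity at
`x_c` for every prefix/suffix class of every crux instance. With `CornerLoc.stub_reduction` (p98583):
`InterlacedTP2At x_c → LeftRightFKG`. [folklore] -/
theorem stub_cornerAssembly :
    (∀ (Ω : Set ℂ) (δ : ℝ) (a b : Site 2), ClassDictionaryAt Ω δ a b) →
    (∀ x : ℝ, 0 < x → AllMeetProportionalAt x) →
    (∀ x : ℝ, 0 < x → BoundaryTP2.InterlacedTP2At x → CornerQuadrupleTP2At x) →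
    BoundaryTP2.InterlacedTP2At SAW.criticalFugacity → CornerCritical :=
  fun hD hP hQ hcore =>
    CornerAssembly.corner_of_parts SAW.criticalFugacity_pos_lt_one'.1 hD (hP _ SAW.criticalFugacity_pos_lt_one'.1)
      (hQ _ SAW.criticalFugacity_pos_lt_one'.1 hcore)

end Summit.CriticalPhenomena.SAWScalingLimit.Theorems.LeftRightFKG.CornerLoc

end
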